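import Mathlib
import HarnessLib
import Literature.MathematicalPhysics.QuantumFieldTheory.YangMillsOS
import Literature.MathematicalPhysics.QuantumFieldTheory.Sweep1ShenZhuZhuProofs
import Literature.MathematicalPhysics.QuantumLattice.LatticeGaugeDLRCovarianceSplit
import Summits.QuantumFields.YangMills.Theorems.PencilRigidityCurvatureKernelBoundTorusFiniteSizeRate
import Summits.QuantumFields.YangMills.Theorems.PencilRigidityCurvatureKernelBoundInfiniteVolumeCurvatureClustering
import Summits.QuantumFields.YangMills.Theorems.PencilRigidityCurvatureKernelBoundLatticeSchwingerPairContinuity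
import Summits.QuantumFields.YangMills.Theorems.PencilRigidityCurvatureKernelBoundLatticeWindowTransferLemmas
import Summits.QuantumFields.YangMills.Theorems.PencilRigidityCurvatureKernelBoundTorusInfiniteVolumeComparison

/-!
# `CurvatureKernelBound` — brick `TorusInfiniteVolumeComparisonR`
# (crux stmt-QuantumFields-11687, line `coupling-trichotomy`)

The closed-coupling-disc variant of the brick `TorusInfiniteVolumeComparison`: the finite-size
hypothesis and the per-step coupling condition are typed on a closed disc `|β| ≤ β'` of arbitrary
radius `β'` (a new real parameter) instead of the open disc `|β| < β₁(4, ρ)/4`.  The radius is pure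
bookkeeping — the per-step hypothesis `|β_k| ≤ β'` is used only to feed the finite-size rate — so the
proof is a re-threading of the original one, whose public lemmas (`mem_box_floor_of_apply_ne_zero`,
`fst_mem_box_of_mem_image_edgeShift`, `latticeTruncated_eq_sum_cov`) are reused by import.

At step `k` of a scaling scheme (torus of side `2L_k+1`, spacing `a`, coupling `β_k`, renormalisation
`c`) the TRUNCATED renormalised lattice two-point function of the curvature `Q = r.curvature.F` is
`LS₂(f,h) − LS₁(f)LS₁(h) = c² a⁸ Σ_{x,y} f(ax) h(ay) Cov_T(Q_x, Q_y)` (`Q_x = Q ∘ translate x`, torus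
state; the additive counterterms cancel: `latticeTruncated_eq_sum_cov`).  It is compared with the
infinite-volume model `c² a⁸ Σ f(ax) h(ay) (P(y−x) − q²)` built from the box limits `q = lim⟨Q_x⟩_Λ`,
`P(y−x) = lim⟨Q_xQ_y⟩_Λ` of the free-boundary state, using only the HYPOTHESIS of a quantitative
finite-size rate `|⟨F⟩_{T,2L+1} − lim_Λ⟨F⟩_Λ| ≤ A(n) e^{−μ'(L−R)}` for normalised observables on `≤ n`
bonds based in `[-R,R]⁴` at couplings `|β| ≤ β'`, applied to `Q_xQ_y/C_Q²`, `Q_x/C_Q`, `Q_y/C_Q`: a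
contributing site (`f(ax) ≠ 0`, `supp f ⊆ B̄(0,T)`) lies in `[-⌊T/a⌋, ⌊T/a⌋]⁴`
(`mem_box_floor_of_apply_ne_zero`), the bonds of `Q_x` are based in `[-(⌊T/a⌋+1), ⌊T/a⌋+1]⁴`
(`fst_mem_box_of_mem_image_edgeShift`), and `R = ⌊T/a⌋+1 < L_k` is the side condition
`T/a + 2 < L_k`.  Per contributing pair `|Cov_T(Q_x,Q_y) − (P − q²)| ≤ 3 C_Q² A⁺ e^{−μ'(L_k − (T/a+2))}`;
summing against `|f(ax)||h(ay)|` gives the statement with `K = 3 C_Q² max(A(2|supp Q|), 0)`.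
[folklore]
-/

noncomputable section

open scoped BigOperators Topology SchwartzMap
open MeasureTheory Filter
open Literature.MathematicalPhysics.QuantumLattice Literature.MathematicalPhysics.QuantumFieldTheory
open Literature.Probability.LatticeModels (Site box mem_box HasBoxLimit)
open Summit.QuantumFields.YangMills.Theorems.StrongCouplingIRTrivial.TwoPoint

namespace Summit.QuantumFields.YangMills.Theorems.CurvatureKernel

/-! ## The registered theorem -/

/-- **Brick `TorusInfiniteVolumeComparisonR`** (registered signature verbatim). Given a quantitative
finite-size rate `|⟨F⟩_{T,2L+1} − lim_Λ⟨F⟩_Λ| ≤ A(n) e^{−μ'(L−R)}` for normalised observables on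
`≤ n` bonds based in `[-R, R]⁴`, valid at every coupling of the closed disc `|β| ≤ β'`, there is `K`
(depending on `r` and `A` only) such that at every step `k` of the scheme with `|β_k| ≤ β'`, for box
limits `q` of `⟨Q_x⟩` and `P(y − x)` of `⟨Q_x Q_y⟩` (`Q` the curvature) and test functions `f, h`
supported in `B̄(0, T)` with `T/a_k + 2 < L_k`, the truncated renormalised lattice two-point
function differs from its infinite-volume model `c_k² a_k⁸ Σ f(a x) h(a y) (P(y−x) − q²)` by at
most `c_k² K e^{−μ'(L_k − (T/a_k + 2))} (a_k⁴ Σ|f(a x)|)(a_k⁴ Σ|h(a y)|)`. See the module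
docstring. [folklore] -/
theorem TorusInfiniteVolumeComparisonR : ∀ (G : Type) [Group G] [TopologicalSpace G] [IsTopologicalGroup G] [CompactSpace G] [MeasurableSpace G] [BorelSpace G] (r : Literature.MathematicalPhysics.QuantumFieldTheory.LatticeRep G) (sch : Literature.MathematicalPhysics.QuantumFieldTheory.SpeciesScheme (Literature.MathematicalPhysics.QuantumFieldTheory.YMSpecies G)) (β' μ' : ℝ) (A : ℕ → ℝ), 0 < μ' → (∀ (n : ℕ) (B : Finset (Literature.MathematicalPhysics.QuantumLattice.ZdEdge 4)) (R : ℕ), B.card ≤ n → (∀ e ∈ B, e.1 ∈ Literature.Probability.LatticeModels.box 4 R) → ∀ (F : Literature.MathematicalPhysics.QuantumFieldTheory.ZdGaugeConfig 4 G → ℝ), Measurable F → (∀ U, |F U| ≤ 1) → DependsOn F (B : Set (Literature.MathematicalPhysics.QuantumLattice.ZdEdge 4)) → ∀ (β gβ : ℝ), |β| ≤ β' → Literature.Probability.LatticeModels.HasBoxLimit (fun Λ => Literature.MathematicalPhysics.QuantumFieldTheory.zdExpect r.ρ β Λ F) gβ → ∀ L : ℕ, R < L → |Literature.MathematicalPhysics.QuantumFieldTheory.wilsonExpectation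 (d := 4) (L := 2 * L + 1) r.ρ β (Literature.MathematicalPhysics.QuantumLattice.toTorusObservable (2 * L + 1) F) - gβ| ≤ A n * Real.exp (-(μ' * ((L : ℝ) - R)))) → ∃ K : ℝ, ∀ (k : ℕ) (q : ℝ) (P : Literature.Probability.LatticeModels.Site 4 → ℝ), |sch.β k| ≤ β' → (∀ x : Literature.Probability.LatticeModels.Site 4, Literature.Probability.LatticeModels.HasBoxLimit (fun Λ => Literature.MathematicalPhysics.QuantumFieldTheory.zdExpect r.ρ (sch.β k) Λ (r.curvature.F ∘ Literature.MathematicalPhysics.QuantumFieldTheory.ZdGaugeConfig.translate x)) q) → (∀ x y : Literature.Probability.LatticeModels.Site 4, Literature.Probability.LatticeModels.HasBoxLimit (fun Λ => Literature.MathematicalPhysics.QuantumFieldTheory.zdExpect r.ρ (sch.β k) Λ (fun U => r.curvature.F (Literature.MathematicalPhysics.QuantumFieldTheory.ZdGaugeConfig.translate x U) * r.curvature.F (Literature.MathematicalPhysics.QuantumFieldTheory.ZdGaugeConfig.translate y U))) (P (y - x))) → ∀ (T : ℝ) (f h : SchwartzMap (EuclideanSpace ℝ (Fin 4)) ℝ),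 0 < T → tsupport (f : EuclideanSpace ℝ (Fin 4) → ℝ) ⊆ Metric.closedBall 0 T → tsupport (h : EuclideanSpace ℝ (Fin 4) → ℝ) ⊆ Metric.closedBall 0 T → T / sch.a k + 2 < sch.L k → |Literature.MathematicalPhysics.QuantumFieldTheory.latticeSchwinger r.ρ sch (fun s => s.F) k 2 (fun _ => r.curvature) ![f, h] - Literature.MathematicalPhysics.QuantumFieldTheory.latticeSchwinger r.ρ sch (fun s => s.F) k 1 (fun _ => r.curvature) (fun _ => f) * Literature.MathematicalPhysics.QuantumFieldTheory.latticeSchwinger r.ρ sch (fun s => s.F) k 1 (fun _ => r.curvature) (fun _ => h) - sch.c r.curvature k ^ 2 * (sch.a k ^ 8 * ∑ x ∈ Literature.Probability.LatticeModels.box 4 (sch.L k), ∑ y ∈ Literature.Probability.LatticeModels.box 4 (sch.L k), f (sch.a k • Literature.MathematicalPhysics.QuantumLattice.siteToE x) * h (sch.a k • Literature.MathematicalPhysics.QuantumLattice.siteToE y) * (P (y - x) - q ^ 2))| ≤ sch.c r.curvature k ^ 2 * K * Real.exp (-(μ' * ((sch.L k : ℝ) - (T / sch.a k + 2)))) * ((sch.a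 k ^ 4 * ∑ x ∈ Literature.Probability.LatticeModels.box 4 (sch.L k), |f (sch.a k • Literature.MathematicalPhysics.QuantumLattice.siteToE x)|) * (sch.a k ^ 4 * ∑ y ∈ Literature.Probability.LatticeModels.box 4 (sch.L k), |h (sch.a k • Literature.MathematicalPhysics.QuantumLattice.siteToE y)|)) := by
  intro G _ _ _ _ _ _ r sch β' μ' A hμ' hA
  -- constants depending on `r` and `A` only
  obtain ⟨C, hC⟩ := r.curvature.bounded
  set CQ : ℝ := max C 1 with hCQ
  have hCQ1 : (1 : ℝ) ≤ CQ := le_max_right _ _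
  have hCQ0 : (0 : ℝ) < CQ := one_pos.trans_le hCQ1
  have hCQne : CQ ≠ 0 := hCQ0.ne'
  have hQb : ∀ U, |r.curvature.F U| ≤ CQ := fun U => (hC U).trans (le_max_left _ _)
  set n₀ : ℕ := 2 * r.curvature.supp.card with hn₀
  refine ⟨3 * CQ ^ 2 * max (A n₀) 0, ?_⟩
  intro k q P hβk hq hP T f h hT hf hh hTL
  have ha : 0 < sch.a k := sch.a_pos k
  -- the radius of the cube containing all contributing bonds, and the rate
  obtain ⟨R, hR⟩ : ∃ R : ℕ, R = ⌊T / sch.a k⌋₊ + 1 := ⟨_, rfl⟩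
  have hfloor : (⌊T / sch.a k⌋₊ : ℝ) ≤ T / sch.a k := Nat.floor_le (div_nonneg hT.le ha.le)
  have hRle : (R : ℝ) ≤ T / sch.a k + 1 := by
    rw [hR]; push_cast; linarith
  have hRL : R < sch.L k := by exact_mod_cast (show (R : ℝ) < sch.L k by linarith)
  have hD0 : 0 ≤ max (A n₀) 0 * Real.exp (-(μ' * ((sch.L k : ℝ) - (T / sch.a k + 2)))) :=
    mul_nonneg (le_max_right _ _) (Real.exp_pos _).le
  have he : A n₀ * Real.exp (-(μ' * ((sch.L k : ℝ) - R))) ≤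
      max (A n₀) 0 * Real.exp (-(μ' * ((sch.L k : ℝ) - (T / sch.a k + 2)))) :=
    (mul_le_mul_of_nonneg_right (le_max_left _ _) (Real.exp_pos _).le).trans
      (mul_le_mul_of_nonneg_left
        (Real.exp_le_exp.2 (neg_le_neg (mul_le_mul_of_nonneg_left (by linarith) hμ'.le)))
        (le_max_right _ _))
  -- the torus Wilson state at step `k` and the shifted, lifted curvature
  obtain ⟨μ, hμ⟩ : ∃ μ : Measure (GaugeConfig 4 (sch.side k) G), μ = wilsonMeasure r.ρ (sch.β k) :=
    ⟨_, rfl⟩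
  haveI : IsProbabilityMeasure μ := by
    rw [hμ]
    exact isProbabilityMeasure_wilsonMeasure (d := 4) (L := sch.side k) r.ρ r.continuous (sch.β k)
  obtain ⟨X, hXapp⟩ : ∃ X : Site 4 → GaugeConfig 4 (sch.side k) G → ℝ,
      ∀ x U, X x U = r.curvature.F (configShift (-x) (torusLift (sch.side k) U)) :=
    ⟨_, fun _ _ => rfl⟩
  have hXb : ∀ x U, |X x U| ≤ CQ := fun x U => by
    rw [hXapp]
    exact hQb _
  have hEXb : ∀ x, |∫ U, X x U ∂μ| ≤ CQ := fun x => abs_integral_le_of_abs_le (hXb x)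
  have hqb : |q| ≤ CQ :=
    le_of_tendsto' (Filter.Tendsto.abs (hq 0)) fun L =>
      abs_zdExpect_le r.continuous fun U => hQb _
  -- the normalised translated observables fed to the finite-size hypothesis
  obtain ⟨F1, hF1⟩ : ∃ F1 : Site 4 → ZdGaugeConfig 4 G → ℝ,
      ∀ x U, F1 x U = r.curvature.F (ZdGaugeConfig.translate x U) / CQ := ⟨_, fun _ _ => rfl⟩
  obtain ⟨F2, hF2⟩ : ∃ F2 : Site 4 → Site 4 → ZdGaugeConfig 4 G → ℝ,
      ∀ x y U, F2 x y U = r.curvature.F (ZdGaugeConfig.translate x U) *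
        r.curvature.F (ZdGaugeConfig.translate y U) / CQ ^ 2 := ⟨_, fun _ _ _ => rfl⟩
  have hmt : ∀ x : Site 4,
      Measurable (ZdGaugeConfig.translate x : ZdGaugeConfig 4 G → ZdGaugeConfig 4 G) := fun x => by
    rw [translate_eq_configShift]
    exact (configShift (-x)).measurable
  have hF1m : ∀ x, Measurable (F1 x) := fun x => by
    rw [show F1 x = fun U => r.curvature.F (ZdGaugeConfig.translate x U) / CQ from funext (hF1 x)]
    exact (r.curvature.measurable.comp (hmt x)).div_const CQ
  have hF2m : ∀ x y, Measurable (F2 x y) := fun x y => by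
    rw [show F2 x y = fun U => r.curvature.F (ZdGaugeConfig.translate x U) *
      r.curvature.F (ZdGaugeConfig.translate y U) / CQ ^ 2 from funext (hF2 x y)]
    exact ((r.curvature.measurable.comp (hmt x)).mul (r.curvature.measurable.comp (hmt y))).div_const _
  have hF1b : ∀ x U, |F1 x U| ≤ 1 := fun x U => by
    rw [hF1, abs_div, abs_of_pos hCQ0, div_le_one hCQ0]
    exact hQb _
  have hF2b : ∀ x y U, |F2 x y U| ≤ 1 := fun x y U => by
    rw [hF2, abs_div, abs_mul, abs_of_pos (pow_pos hCQ0 2), div_le_one (pow_pos hCQ0 2), sq]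
    exact mul_le_mul (hQb _) (hQb _) (abs_nonneg _) hCQ0.le
  -- supports: translates of the curvature support
  have hcyl : ∀ (x : Site 4) (U V : ZdGaugeConfig 4 G),
      (∀ e ∈ r.curvature.supp.image (edgeShift x), U e = V e) →
      r.curvature.F (ZdGaugeConfig.translate x U) = r.curvature.F (ZdGaugeConfig.translate x V) := by
    intro x U V hUV
    refine r.curvature.isCylinder fun e he => ?_
    have h' := hUV (edgeShift x e) (Finset.mem_image_of_mem _ (Finset.mem_coe.1 he))
    rwa [edgeShift_apply] at h'
  have hF1d : ∀ x : Site 4, DependsOn (F1 x) ↑(r.curvature.supp.image (edgeShift x)) := by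
    intro x U V hUV
    rw [hF1, hF1, hcyl x U V fun e he => hUV e (Finset.mem_coe.2 he)]
  have hF2d : ∀ x y : Site 4, DependsOn (F2 x y)
      ↑(r.curvature.supp.image (edgeShift x) ∪ r.curvature.supp.image (edgeShift y)) := by
    intro x y U V hUV
    rw [hF2, hF2, hcyl x U V fun e he => hUV e (Finset.mem_coe.2 (Finset.mem_union_left _ he)),
      hcyl y U V fun e he => hUV e (Finset.mem_coe.2 (Finset.mem_union_right _ he))]
  have hcard1 : ∀ x : Site 4, (r.curvature.supp.image (edgeShift x)).card ≤ n₀ := fun x => by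
    have := Finset.card_image_le (s := r.curvature.supp) (f := ⇑(edgeShift x))
    omega
  have hcard2 : ∀ x y : Site 4,
      (r.curvature.supp.image (edgeShift x) ∪ r.curvature.supp.image (edgeShift y)).card ≤ n₀ := by
    intro x y
    have h1 := Finset.card_image_le (s := r.curvature.supp) (f := ⇑(edgeShift x))
    have h2 := Finset.card_image_le (s := r.curvature.supp) (f := ⇑(edgeShift y))
    have h3 := Finset.card_union_le (r.curvature.supp.image (edgeShift x))
      (r.curvature.supp.image (edgeShift y))
    omega
  have hB1 : ∀ x ∈ box 4 ⌊T / sch.a k⌋₊, ∀ e ∈ r.curvature.supp.image (edgeShift x),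
      e.1 ∈ box 4 R := fun x hx e he => by
    rw [hR]
    exact fst_mem_box_of_mem_image_edgeShift r hx he
  have hB2 : ∀ x ∈ box 4 ⌊T / sch.a k⌋₊, ∀ y ∈ box 4 ⌊T / sch.a k⌋₊,
      ∀ e ∈ r.curvature.supp.image (edgeShift x) ∪ r.curvature.supp.image (edgeShift y),
        e.1 ∈ box 4 R := fun x hx y hy e he => by
    rcases Finset.mem_union.1 he with he | he
    exacts [hB1 x hx e he, hB1 y hy e he]
  -- the box limits of the normalised observables
  have hF1lim : ∀ x : Site 4,
      HasBoxLimit (fun Λ => zdExpect r.ρ (sch.β k) Λ (F1 x)) (q / CQ) := by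
    intro x
    refine (Filter.Tendsto.div_const (hq x) CQ).congr fun L => ?_
    show zdExpect r.ρ (sch.β k) (box 4 L) (r.curvature.F ∘ ZdGaugeConfig.translate x) / CQ =
      zdExpect r.ρ (sch.β k) (box 4 L) (F1 x)
    simp only [zdExpect]
    rw [← integral_div]
    exact integral_congr_ae (ae_of_all _ fun U => by simp only [hF1, Function.comp_apply])
  have hF2lim : ∀ x y : Site 4,
      HasBoxLimit (fun Λ => zdExpect r.ρ (sch.β k) Λ (F2 x y)) (P (y - x) / CQ ^ 2) := by
    intro x y
    refine (Filter.Tendsto.div_const (hP x y) (CQ ^ 2)).congr fun L => ?_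
    show zdExpect r.ρ (sch.β k) (box 4 L) (fun U => r.curvature.F (ZdGaugeConfig.translate x U) *
        r.curvature.F (ZdGaugeConfig.translate y U)) / CQ ^ 2 =
      zdExpect r.ρ (sch.β k) (box 4 L) (F2 x y)
    simp only [zdExpect]
    rw [← integral_div]
    exact integral_congr_ae (ae_of_all _ fun U => by rw [hF2])
  -- the torus expectations of the normalised observables
  have hWX1 : ∀ x : Site 4, wilsonExpectation (L := 2 * sch.L k + 1) r.ρ (sch.β k)
      (toTorusObservable (2 * sch.L k + 1) (F1 x)) = (∫ U, X x U ∂μ) / CQ := by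
    intro x
    rw [← integral_div, hμ]
    show ∫ U, F1 x (torusLift (sch.side k) U) ∂(wilsonMeasure r.ρ (sch.β k)) = _
    refine integral_congr_ae (ae_of_all _ fun U => ?_)
    show F1 x (torusLift (sch.side k) U) = X x U / CQ
    simp only [hF1, hXapp, translate_eq_configShift]
  have hWX2 : ∀ x y : Site 4, wilsonExpectation (L := 2 * sch.L k + 1) r.ρ (sch.β k)
      (toTorusObservable (2 * sch.L k + 1) (F2 x y)) = (∫ U, X x U * X y U ∂μ) / CQ ^ 2 := by
    intro x y
    rw [← integral_div, hμ]
    show ∫ U, F2 x y (torusLift (sch.side k) U) ∂(wilsonMeasure r.ρ (sch.β k)) = _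
    refine integral_congr_ae (ae_of_all _ fun U => ?_)
    show F2 x y (torusLift (sch.side k) U) = X x U * X y U / CQ ^ 2
    simp only [hF2, hXapp, translate_eq_configShift]
  -- the finite-size hypothesis on contributing sites
  have hW1 : ∀ x ∈ box 4 ⌊T / sch.a k⌋₊, |(∫ U, X x U ∂μ) - q| ≤
      CQ * (max (A n₀) 0 * Real.exp (-(μ' * ((sch.L k : ℝ) - (T / sch.a k + 2))))) := by
    intro x hx
    have h1 := hA n₀ _ R (hcard1 x) (hB1 x hx) (F1 x) (hF1m x) (hF1b x) (hF1d x) (sch.β k)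
      (q / CQ) hβk (hF1lim x) (sch.L k) hRL
    rw [hWX1 x] at h1
    have e1 : (∫ U, X x U ∂μ) - q = CQ * ((∫ U, X x U ∂μ) / CQ - q / CQ) := by
      field_simp
    rw [e1, abs_mul, abs_of_pos hCQ0]
    exact mul_le_mul_of_nonneg_left (h1.trans he) hCQ0.le
  have hW2 : ∀ x ∈ box 4 ⌊T / sch.a k⌋₊, ∀ y ∈ box 4 ⌊T / sch.a k⌋₊,
      |(∫ U, X x U * X y U ∂μ) - P (y - x)| ≤
        CQ ^ 2 * (max (A n₀) 0 * Real.exp (-(μ' * ((sch.L k : ℝ) - (T / sch.a k + 2))))) := by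
    intro x hx y hy
    have h2 := hA n₀ _ R (hcard2 x y) (hB2 x hx y hy) (F2 x y) (hF2m x y) (hF2b x y) (hF2d x y)
      (sch.β k) (P (y - x) / CQ ^ 2) hβk (hF2lim x y) (sch.L k) hRL
    rw [hWX2 x y] at h2
    have e2 : (∫ U, X x U * X y U ∂μ) - P (y - x) =
        CQ ^ 2 * ((∫ U, X x U * X y U ∂μ) / CQ ^ 2 - P (y - x) / CQ ^ 2) := by
      field_simp
    rw [e2, abs_mul, abs_of_pos (pow_pos hCQ0 2)]
    exact mul_le_mul_of_nonneg_left (h2.trans he) (pow_pos hCQ0 2).le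
  -- per-pair comparison of the torus covariance with the infinite-volume model
  have hpair : ∀ x ∈ box 4 ⌊T / sch.a k⌋₊, ∀ y ∈ box 4 ⌊T / sch.a k⌋₊,
      |(∫ U, X x U * X y U ∂μ) - (∫ U, X x U ∂μ) * (∫ U, X y U ∂μ) - (P (y - x) - q ^ 2)| ≤
        3 * CQ ^ 2 * (max (A n₀) 0 * Real.exp (-(μ' * ((sch.L k : ℝ) - (T / sch.a k + 2))))) := by
    intro x hx y hy
    have exy := hW2 x hx y hy
    have ex := hW1 x hx
    have ey := hW1 y hy
    have by' := hEXb y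
    set D : ℝ := max (A n₀) 0 * Real.exp (-(μ' * ((sch.L k : ℝ) - (T / sch.a k + 2)))) with hD
    set Ix : ℝ := ∫ U, X x U ∂μ with hIx
    set Iy : ℝ := ∫ U, X y U ∂μ with hIy
    set Ixy : ℝ := ∫ U, X x U * X y U ∂μ with hIxy
    have hCD : 0 ≤ CQ * D := mul_nonneg hCQ0.le hD0
    have key : Ixy - Ix * Iy - (P (y - x) - q ^ 2) =
        (Ixy - P (y - x)) - ((Ix - q) * Iy + q * (Iy - q)) := by ring
    rw [key]
    calc |(Ixy - P (y - x)) - ((Ix - q) * Iy + q * (Iy - q))|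
        ≤ |Ixy - P (y - x)| + |(Ix - q) * Iy + q * (Iy - q)| := abs_sub _ _
      _ ≤ |Ixy - P (y - x)| + (|Ix - q| * |Iy| + |q| * |Iy - q|) := by
          refine add_le_add le_rfl ((abs_add_le _ _).trans_eq ?_)
          rw [abs_mul, abs_mul]
      _ ≤ CQ ^ 2 * D + (CQ * D * CQ + CQ * (CQ * D)) :=
          add_le_add exy (add_le_add (mul_le_mul ex by' (abs_nonneg _) hCD)
            (mul_le_mul hqb ey (abs_nonneg _) hCQ0.le))
      _ = 3 * CQ ^ 2 * D := by ring
  -- the truncated function minus the model, as a double sum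
  have hsum : latticeSchwinger r.ρ sch (fun s => s.F) k 2 (fun _ => r.curvature) ![f, h] -
      latticeSchwinger r.ρ sch (fun s => s.F) k 1 (fun _ => r.curvature) (fun _ => f) *
        latticeSchwinger r.ρ sch (fun s => s.F) k 1 (fun _ => r.curvature) (fun _ => h) -
      sch.c r.curvature k ^ 2 * (sch.a k ^ 8 * ∑ x ∈ box 4 (sch.L k), ∑ y ∈ box 4 (sch.L k),
        f (sch.a k • siteToE x) * h (sch.a k • siteToE y) * (P (y - x) - q ^ 2)) =
      ∑ x ∈ box 4 (sch.L k), ∑ y ∈ box 4 (sch.L k),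
        sch.c r.curvature k * sch.c r.curvature k * sch.a k ^ 8 *
            (f (sch.a k • siteToE x) * h (sch.a k • siteToE y)) *
          ((∫ U, X x U * X y U ∂μ) - (∫ U, X x U ∂μ) * (∫ U, X y U ∂μ) - (P (y - x) - q ^ 2)) := by
    rw [latticeTruncated_eq_sum_cov r sch r.curvature k f h μ hμ X hXapp, Finset.mul_sum,
      Finset.mul_sum, ← Finset.sum_sub_distrib]
    refine Finset.sum_congr rfl fun x _ => ?_
    rw [Finset.mul_sum, Finset.mul_sum, ← Finset.sum_sub_distrib]
    refine Finset.sum_congr rfl fun y _ => ?_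
    ring
  -- termwise bound
  have hterm : ∀ x ∈ box 4 (sch.L k), ∀ y ∈ box 4 (sch.L k),
      |sch.c r.curvature k * sch.c r.curvature k * sch.a k ^ 8 *
            (f (sch.a k • siteToE x) * h (sch.a k • siteToE y)) *
          ((∫ U, X x U * X y U ∂μ) - (∫ U, X x U ∂μ) * (∫ U, X y U ∂μ) - (P (y - x) - q ^ 2))| ≤
        sch.c r.curvature k ^ 2 * (3 * CQ ^ 2 * max (A n₀) 0) *
            Real.exp (-(μ' * ((sch.L k : ℝ) - (T / sch.a k + 2)))) *
          (sch.a k ^ 4 * sch.a k ^ 4 * (|f (sch.a k • siteToE x)| * |h (sch.a k • siteToE y)|)) := by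
    intro x _ y _
    by_cases hfx : f (sch.a k • siteToE x) = 0
    · rw [hfx]; simp
    by_cases hhy : h (sch.a k • siteToE y) = 0
    · rw [hhy]; simp
    have hx := mem_box_floor_of_apply_ne_zero hf ha hfx
    have hy := mem_box_floor_of_apply_ne_zero hh ha hhy
    have hp := hpair x hx y hy
    have ha8 : |sch.a k ^ 8| = sch.a k ^ 4 * sch.a k ^ 4 := by
      rw [abs_of_nonneg (by positivity)]; ring
    rw [abs_mul]
    refine (mul_le_mul_of_nonneg_left hp (abs_nonneg _)).trans_eq ?_
    simp only [abs_mul, abs_mul_abs_self, ha8]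
    ring
  -- sum up
  rw [hsum]
  refine (Finset.abs_sum_le_sum_abs _ _).trans ?_
  refine (Finset.sum_le_sum fun x _ => Finset.abs_sum_le_sum_abs _ _).trans ?_
  refine (Finset.sum_le_sum fun x hx => Finset.sum_le_sum fun y hy => hterm x hx y hy).trans_eq ?_
  rw [mul_sum_mul_mul_sum, Finset.mul_sum]
  refine Finset.sum_congr rfl fun x _ => ?_
  rw [Finset.mul_sum]

end Summit.QuantumFields.YangMills.Theorems.CurvatureKernel

end
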